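import Mathlib
import HarnessLib
import Summits.HubbardSuperconductivity.HubbardSuperconductivity.Theorems.KLProgrammeKLRegimeSplitFermiPointC4Bounds

/-!
# Route `KLProgramme` — ENGINE child `KLRegimeEngineV11` (stmt-HubbardSuperconductivity-19823), two-leg stubs: the `C⁴` bounds of the
# Fermi-point map KEYED BY `FrameOK` IN THE KL REGIME (cell gate-hubbard-kl, seat p1b g5)

`…SplitFermiPointC4Bounds` bounds `γ = toLp ∘ k_F^K` to order four for a frame with `C²` size `A` (small) and `C⁴` size `A'`.  Here both sizes
are read off the cell's admissibility predicate: for `FrameOK R U N μ K` (pieces `Kp n`, `n ≤ N`, `‖Dʲ(Kp n)‖ ≤ Gfr j·uPow j U·4^{(j−2)n}`,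
`j ≤ 4`), `‖Dʲ(frameShift K)‖ ≤ (N+1)·Gfr j·uPow j U·4^{2N}` for EVERY `j ≤ 4` (`norm_iteratedFDeriv_frameShift_le_of_frameOK_four`; p4's
`…_of_frameOK` is the sharper `j ≤ 2` statement), hence `≤ frameC4Size R U N := 1 + Σ_{j<5} (N+1)·Gfr j·uPow j U·4^{2N}`; and in the regime
`klBetaMin ≤ β ≤ e^{c/U²}`, `0 < c ≤ c₃(R)`, `0 < U ≤ U₀(R)` (p4's `frame_thresholds`: `2A < Dt_min`, `A ≤ 1/20` on `klWindowC`), every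
admissible frame's Fermi-point map is `C⁴` with

  `‖Dⁱ γ(θ)‖ ≤ (20·D_u)ⁱ`, `1 ≤ i ≤ 4`, `D_u = 31104·(24·(4 + 16·frameC4Size R U (nScales β))·9⁴)⁴ / min(Dt_min − 2A, 1)⁴`

(`fermiPointLp_C4_of_frameOK`: the constant is FRAME-free and VOLUME-free; it depends on `(R, U, c, β)` — through `nScales β` in the `C⁴`
size, growth `4^{32·nScales β}` under the crude single-constant bootstrap).  The (E3g) prover feeds it to `twoLegAngularG_of_curve_bounds`.
Proofs only (one bookkeeping abbreviation-free constant spelled out).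
-/

noncomputable section

namespace Summit.HubbardSuperconductivity.HubbardSuperconductivity.Theorems.PerturbedFermiCurve

set_option linter.dupNamespace false -- summit = problem name (single-conjunct summit), D-0017

open Real Set Finset
open Literature.MathematicalPhysics.QuantumLattice Literature.MathematicalPhysics.QuantumLattice.BandSectorCounting
open Summit.HubbardSuperconductivity.HubbardSuperconductivity.Theorems.DispersionFlow
open Summit.HubbardSuperconductivity.HubbardSuperconductivity.Theorems.KLRegimeSplit

/-! ## §1 The `C⁴` size of an admissible frame -/

/-- **`‖Dʲ(frameShift K)‖ ≤ (N+1)·Gfr j·uPow j U·4^{2N}` for every `j ≤ 4`** and every `FrameOK R U N μ K` frame (sum of the piece bounds,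
`4^{(j−2)n} ≤ 4^{2N}`). -/
theorem norm_iteratedFDeriv_frameShift_le_of_frameOK_four {R : RenConsts} (hR : ∀ j, 0 ≤ R.Gfr j) {U : ℝ} {N : ℕ} {μ : ℝ}
    {K : TrigPolyC4v} (hK : FrameOK R U N μ K) (p : Momentum) {j : ℕ} (hj : j ≤ 4) :
    ‖iteratedFDeriv ℝ j (frameShift K) p‖ ≤ ((N : ℝ) + 1) * R.Gfr j * uPow j U * (4 : ℝ) ^ (2 * N) := by
  obtain ⟨-, Kp, hsum, hS⟩ := hK
  have hfs : frameShift K = fun q => ∑ n ∈ range (N + 1), (fun q => -evalM (Kp n) q) q := by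
    funext q
    simp only [frameShift, evalM, hsum (WithLp.ofLp q), Finset.sum_neg_distrib]
  have hterm : ∀ n ∈ range (N + 1), ‖iteratedFDeriv ℝ j (fun q => -evalM (Kp n) q) p‖ ≤ R.Gfr j * uPow j U * (4 : ℝ) ^ (2 * N) := by
    intro n hn
    have hn' : n ≤ N := Nat.lt_succ_iff.mp (mem_range.mp hn)
    have h := hS n hn' j hj p
    have e : (fun q => -evalM (Kp n) q) = -evalM (Kp n) := rfl
    rw [e, iteratedFDeriv_neg_apply, norm_neg]
    refine h.trans (mul_le_mul_of_nonneg_left ?_ (mul_nonneg (hR j) (uPow_nonneg j U)))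
    have hexp : ((j : ℤ) - 2) * n ≤ ((2 * N : ℕ) : ℤ) := by push_cast; nlinarith
    calc (4 : ℝ) ^ (((j : ℤ) - 2) * n) ≤ (4 : ℝ) ^ (((2 * N : ℕ) : ℤ)) := zpow_le_zpow_right₀ (by norm_num) hexp
      _ = (4 : ℝ) ^ (2 * N) := zpow_natCast _ _
  rw [hfs, iteratedFDeriv_fun_sum_apply fun n _ => ((contDiff_evalM (Kp n)).neg).contDiffAt]
  refine (norm_sum_le _ _).trans ((sum_le_sum hterm).trans ?_)
  rw [sum_const, card_range, nsmul_eq_mul]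
  push_cast
  ring_nf
  exact le_rfl

/-- **One `C⁴` size for all orders `j ≤ 4`**: `‖Dʲ(frameShift K)‖ ≤ 1 + Σ_{j<5} (N+1)·Gfr j·uPow j U·4^{2N}` (`≥ 1`). -/
theorem norm_iteratedFDeriv_frameShift_le_frameC4Size {R : RenConsts} (hR : ∀ j, 0 ≤ R.Gfr j) {U : ℝ} {N : ℕ} {μ : ℝ}
    {K : TrigPolyC4v} (hK : FrameOK R U N μ K) (p : Momentum) {j : ℕ} (hj : j ≤ 4) :
    ‖iteratedFDeriv ℝ j (frameShift K) p‖ ≤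
      1 + ∑ i ∈ range 5, ((N : ℝ) + 1) * R.Gfr i * uPow i U * (4 : ℝ) ^ (2 * N) := by
  refine (norm_iteratedFDeriv_frameShift_le_of_frameOK_four hR hK p hj).trans ?_
  have hnn : ∀ i ∈ range 5, 0 ≤ ((N : ℝ) + 1) * R.Gfr i * uPow i U * (4 : ℝ) ^ (2 * N) := fun i _ => by
    have := hR i; have := uPow_nonneg i U; positivity
  have hle := single_le_sum hnn (mem_range.2 (by omega : j < 5))
  linarith

/-! ## §2 In the KL regime -/

/-- **THE FERMI-POINT MAP OF EVERY ADMISSIBLE FRAME IS `C⁴` WITH FRAME-FREE, VOLUME-FREE BOUNDS IN THE KL REGIME.**  For every `R`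
(`Gfr ≥ 0`) there are `c₃, U₀ > 0` such that for `0 < c ≤ c₃`, `0 < U ≤ U₀`, `klBetaMin ≤ β ≤ e^{c/U²}` there is `D ≥ 1` with: for every
`μ ∈ klWindowC` and every `K` with `FrameOK R U (nScales β) μ K`, `γ = (θ ↦ toLp 2 (klFermiPoint μ K θ))` is `C⁴` and `‖Dⁱγ(θ)‖ ≤ Dⁱ`
(`1 ≤ i ≤ 4`).  The witness is `D = 20·31104·(24·(4 + 16 A')·9⁴)⁴/min(Dt_min − 2A, 1)⁴` with `A = 2Gfr₀U + 2Gfr₁U² + Gfr₂c/log 4`,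
`A' = 1 + Σ_{j<5} (nScales β + 1)·Gfr j·uPow j U·4^{2 nScales β}`, `Dt_min` of `bandBounds (−1.1) (−0.1)`. -/
theorem fermiPointLp_C4_of_frameOK (R : RenConsts) (hR : ∀ j, 0 ≤ R.Gfr j) :
    ∃ c₃ : ℝ, 0 < c₃ ∧ ∃ U₀ : ℝ, 0 < U₀ ∧
      ∀ c : ℝ, 0 < c → c ≤ c₃ → ∀ U : ℝ, 0 < U → U ≤ U₀ → ∀ β : ℝ, klBetaMin ≤ β → β ≤ Real.exp (c / U ^ 2) →
      ∃ D : ℝ, 1 ≤ D ∧ ∀ μ ∈ klWindowC, ∀ K : TrigPolyC4v, FrameOK R U (nScales β) μ K →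
        ContDiff ℝ 4 (fun θ : ℝ => (WithLp.toLp 2 (klFermiPoint μ K θ) : Momentum)) ∧
        ∀ i, 1 ≤ i → i ≤ 4 → ∀ θ : ℝ,
          ‖iteratedDeriv i (fun θ : ℝ => (WithLp.toLp 2 (klFermiPoint μ K θ) : Momentum)) θ‖ ≤ D ^ i := by
  have ha : (-4 : ℝ) < -1.1 := by norm_num
  have hab : (-1.1 : ℝ) ≤ -0.1 := by norm_num
  have hb : (-0.1 : ℝ) < 0 := by norm_num
  set B := bandBounds ha hab hb with hBdef
  have hDt := B.Dtmin_pos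
  set κ : ℝ := min B.Dtmin (1 / 5) with hκdef
  have hκ : 0 < κ := lt_min hDt (by norm_num)
  obtain ⟨c₃, hc₃, U₀, hU₀, hthr⟩ := frame_thresholds hR hκ
  refine ⟨c₃, hc₃, U₀, hU₀, ?_⟩
  intro c hc hcle U hU hUle β hβmin hβc
  set A := 2 * R.Gfr 0 * |U| + 2 * R.Gfr 1 * U ^ 2 + R.Gfr 2 * (c / Real.log 4) with hAdef
  set A' := 1 + ∑ i ∈ range 5, ((nScales β : ℝ) + 1) * R.Gfr i * uPow i U * (4 : ℝ) ^ (2 * nScales β) with hA'def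
  set Du : ℝ := 31104 * (24 * (4 + 16 * A') * 9 ^ 4) ^ 4 / (min (B.Dtmin - 2 * A) 1) ^ 4 with hDu
  have h4A : 4 * A ≤ κ := hthr c U hc.le hcle hU hUle
  have hA0 : 0 ≤ A := by
    have h0 := hR 0; have h1 := hR 1; have h2 := hR 2
    have hlog : 0 < Real.log 4 := Real.log_pos (by norm_num)
    positivity
  have hADt : 2 * A < B.Dtmin := by
    have : κ ≤ B.Dtmin := min_le_left _ _
    linarith
  have hA20 : A ≤ 1 / 20 := by
    have : κ ≤ 1 / 5 := min_le_right _ _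
    linarith
  have hA'1 : 1 ≤ A' := by
    have hnn : ∀ i ∈ range 5, 0 ≤ ((nScales β : ℝ) + 1) * R.Gfr i * uPow i U * (4 : ℝ) ^ (2 * nScales β) := fun i _ => by
      have := hR i; have := uPow_nonneg i U; positivity
    have := sum_nonneg hnn
    linarith
  have hd : 0 < min (B.Dtmin - 2 * A) 1 := lt_min (by linarith) one_pos
  have hd1 : min (B.Dtmin - 2 * A) 1 ≤ 1 := min_le_right _ _
  have hB1 : (1 : ℝ) ≤ 24 * (4 + 16 * A') * 9 ^ 4 := by nlinarith
  have hDu1 : 1 ≤ Du := by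
    rw [hDu, le_div_iff₀ (by positivity)]
    have h1 : (min (B.Dtmin - 2 * A) 1) ^ 4 ≤ 1 := pow_le_one₀ hd.le hd1
    nlinarith [one_le_pow₀ (n := 4) hB1]
  refine ⟨20 * Du, by linarith, ?_⟩
  intro μ hμ K hK
  have hAf : ∀ p : Momentum, ∀ j ≤ 2, ‖iteratedFDeriv ℝ j (frameShift K) p‖ ≤ A := fun p j hj =>
    norm_iteratedFDeriv_frameShift_le_of_frameOK_regime hR hc.le hβmin hβc hK p hj
  have hAf' : ∀ p : Momentum, ∀ j ≤ 4, ‖iteratedFDeriv ℝ j (frameShift K) p‖ ≤ A' := fun p j hj =>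
    norm_iteratedFDeriv_frameShift_le_frameC4Size hR hK p hj
  obtain ⟨hlo, hhi⟩ := klWindowC_margin hμ hA20
  exact ⟨contDiff_four_fermiPointLp B hAf hADt hlo hhi,
    fun i hi1 hi4 θ => norm_iteratedDeriv_fermiPointLp_le B hAf hADt hAf' hA'1 hlo hhi i hi1 hi4 θ⟩

end Summit.HubbardSuperconductivity.HubbardSuperconductivity.Theorems.PerturbedFermiCurve

end
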